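import Mathlib.GroupTheory.SpecificGroups.Dihedral
import Literature.Combinatorics.Additive.TripleProductProperty
import Summits.MatrixMultiplication.OmegaCensus.Dihedral8TPPVolume
import HarnessLib

/-!
# `β(D₈ × D₈) ≥ 128 = 2|G| = 2 β(D₈)²`: an `(8,4,4)` TPP triple

ω-census, family (b3).  Framing: lottery ticket; floor = certified bounds/negative ranges.

A kernel-checked (`decide`) TPP triple of type `(8, 4, 4)` in `D₈ × D₈ = DihedralGroup 4 × DihedralGroup 4`
(order `64`): volume `128 = 2|G|`.  It is the lift (through `D₈ × D₈ → D₈ ∘ D₈ = 2^{1+4}_+`, kernel the diagonal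
centre) of a `(4,4,4)` triple of the extraspecial group `2^{1+4}_+` found by kissat (kit j101793/j102194: the
extraspecial group `2^{1+4}_+` has `β = 64 = 2|G|`, every larger Neumann-feasible pattern UNSAT + DRAT, while
`2^{1+4}_− = D₈ ∘ Q₈` has `β = 32 = |G|`).  Since `β(D₈) = 8` (`dihedral8_tpp_volume_le_eight`, gen 1), this is a
second kernel instance of strict supermultiplicativity, now for a square: `β(D₈ × D₈) ≥ 128 > 64 = β(D₈)²`
(`beta_d8_prod_d8_gt_square`).  The sum of the cubes of the character degrees of `D₈ × D₈` is `12² = 144 > 128`, so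
this triple does not beat the Cohn–Umans threshold; the Neumann-feasible patterns of volume `145–180` are kit job
j102270 (lottery ticket).
-/

namespace Summit.MatrixMultiplication.OmegaCensus

open Literature.Combinatorics.Additive Finset

/-- **An `(8,4,4)` TPP triple in `D₈ × D₈`** (volume `128 = 2|G|`). [folklore] -/
theorem d8_prod_d8_tpp_844 :
    TripleProductProperty
      ({(DihedralGroup.r 0, DihedralGroup.r 0), (DihedralGroup.r 2, DihedralGroup.r 2),
        (DihedralGroup.r 0, DihedralGroup.sr 2), (DihedralGroup.r 2, DihedralGroup.sr 0),
        (DihedralGroup.sr 0, DihedralGroup.r 2), (DihedralGroup.sr 2, DihedralGroup.r 0),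
        (DihedralGroup.sr 0, DihedralGroup.sr 0), (DihedralGroup.sr 2, DihedralGroup.sr 2)} :
        Finset (DihedralGroup 4 × DihedralGroup 4))
      ({(DihedralGroup.r 0, DihedralGroup.r 0), (DihedralGroup.r 0, DihedralGroup.sr 3),
        (DihedralGroup.sr 1, DihedralGroup.r 2), (DihedralGroup.sr 1, DihedralGroup.sr 1)} :
        Finset (DihedralGroup 4 × DihedralGroup 4))
      ({(DihedralGroup.r 0, DihedralGroup.r 0), (DihedralGroup.r 1, DihedralGroup.r 3),
        (DihedralGroup.sr 0, DihedralGroup.sr 3), (DihedralGroup.sr 1, DihedralGroup.sr 2)} :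
        Finset (DihedralGroup 4 × DihedralGroup 4)) := by
  unfold TripleProductProperty; decide +kernel

/-- **`β(D₈ × D₈) ≥ 128`.** [folklore] -/
theorem beta_d8_prod_d8_ge_128 :
    ∃ S T U : Finset (DihedralGroup 4 × DihedralGroup 4), TripleProductProperty S T U ∧
      S.card * T.card * U.card = 128 :=
  ⟨_, _, _, d8_prod_d8_tpp_844, by decide⟩

/-- **Strict supermultiplicativity for a square**: `β(D₈ × D₈) ≥ 128 > 64 = β(D₈)²` (every TPP triple of `D₈` has
volume `≤ 8`). [folklore] -/
theorem beta_d8_prod_d8_gt_square :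
    (∃ S T U : Finset (DihedralGroup 4 × DihedralGroup 4), TripleProductProperty S T U ∧
      S.card * T.card * U.card = 128) ∧
    (∀ S T U : Finset (DihedralGroup 4), TripleProductProperty S T U → S.card * T.card * U.card ≤ 8) ∧
    8 * 8 < 128 :=
  ⟨beta_d8_prod_d8_ge_128, fun S T U h => dihedral8_tpp_volume_le_eight S T U h, by norm_num⟩

end Summit.MatrixMultiplication.OmegaCensus
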